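import Summits.ResolutionOfSingularities.ResolutionOfSingularities.Theorems.PurelyInseparableDim4ResConeDInfFrames
import Summits.ResolutionOfSingularities.ResolutionOfSingularities.Theorems.PurelyInseparableDim4ResConeBInfLoseStep
import Summits.ResolutionOfSingularities.ResolutionOfSingularities.Theorems.PurelyInseparableDim4PhiLineSupercriticalTranslated
import Summits.ResolutionOfSingularities.ResolutionOfSingularities.Theorems.PurelyInseparableDim4PhiLineSupercriticalLabel
import HarnessLib
import HarnessLib.Audit.Tags

/-!
# Purely inseparable four-folds — the D∞ LOSE STEP at `(p,d) = (5,4)` (L₄ of the heavy-line assembly, CARD I-1-10)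
# (cell `res-dim4-pi`, K2(p) lane, slice C `(5,4)`, TAIL-D, class D∞ = «one letter of weight 2»)

[OURS · counted 0 · cell `res-dim4-pi` · K2(p) lane holder res-dim4-p-12 g4; desk default (ii) 2026-08-29 07:29Z «heavy line WANTED:
K₄ = p-7 g5, Φ-input = p-11 g5, L₄ = p-2 g5, E₄ = p-9 g4»; seat res-dim4-p-2 g5 over res-dim4-p-7 g5's `…ResConeDInfFrames`
(`dInf_factorisation`, `dInf_step_factorisation`), the holder's W₄ `…FourWeights` (`dInf_pattern`), res-dim4-p-9 g4's `…ResConeBInfFrames`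
(twist / replace-row / arrival inverses), res-dim4-p-12 g2's `direction_mem_resVertex_of_shade_eq`, res-dim4-p-11 g4/g5's Φ-line
((K-Φ2) XV `betaS_step_le_of_lose_of_child_pow`, (K-Φ1)-n `mul_alphaS_le_of_isIsolated`, XVI `exists_label_readaptation_of_step_pow`,
FrameMoves, VII, II, XI, XIII, XIV) and this seat's (5,3) twin `…ResConeBInfLoseStep` and (R3b-n) `…PhiLineSupercriticalTranslated`.]
Nothing here proves TAIL-D, K2(5), the β_h line or resolution of singularities in dimension ≥ 4 / characteristic `p` — NOT proved.
AI kernel work, weaker than expert review.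

**`dInf_lose_step`** = the (5,4) twin of `bInf_lose_step`: on TAIL-D data (isolated witnessed `Step0 5` chain, `x^{r₀} ∣ F₀`, off the
floor, shade `≡ 4` and `e_G ≡ 2` from `k₀`), at a `(2,1)`-state `k ≥ k₀` (`|r_k| = 3`) carrying an ENTRY₄-invariant frame `L` (left
inverse `M`, `u₁ = e_h` with `r_k h = 2`, y-rows annihilating `resVertex (c k)`, `pts ≠ ∅` and `4! < δs` for `(G_k)`), the child
`c (k+1)` carries a RUN₄-invariant frame `L′` with critical letter the newborn `j k` (`r_{k+1} (j k) = 2`, `pts′ ≠ ∅`, `4! < δs′`,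
`2·αs′ ≤ 4!`, `0 < αs′`) and `βs′ ≤ βs`.  Route, word for word that of `bInf_lose_step` with `(d, |r|) = (3, 4) ↦ (4, 3)`: the step hits
`h` (W₄ `dInf_pattern`: `j k = h ∨ b k h ≠ 0`, `r′(j k) = 2`); TWIST `ũ₂ = u₂ − λu₁` so that every non-pivot row kills the direction
(`direction_mem_resVertex_of_shade_eq`, `o = 7 < 10`); the LOSE law at the SUPERCRITICAL newborn (`r′ = 2`, `n = 3 < d = 4`, cleaning term
in `(x_{j k}^3)`, transfer from the child side) — chart `j k = h`: `PhiLine.betaS_step_le_of_lose_of_child_pow`, chart `≠ h` (then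
`b k h ≠ 0`): `PhiLine.betaS_step_le_of_lose_translated_of_child_pow` — with the child's `pts′ ≠ ∅` and `4·αs′ ≤ 2·4!` from (K-Φ1)-n
`PhiLine.mul_alphaS_le_of_isIsolated` (`5 ≤ r′_{j k} + 3`); departure label (XIV, `d = 4 < 5`), VII transport, II residual, XVI
re-adaptation `exists_label_readaptation_of_step_pow` (`e = 3`, no order hypothesis on the uncleaned weak transform — res-dim4-p-11 g5's
located «order-raising cleaning»), XIII for the new y-rows; `0 < αs′ = δs − 4!`.  **`dInf_stub_lose`** re-associates it into the named
hypothesis `hL` of res-dim4-p-7 g5's `no_dInf_tail_four_five_of_EL` (`…ResConeDInfAssembly`).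

[cite: CossartJannsenSaito2020, Lemma 11.5, Lemma 12.1 (3), Lemma 12.2 (1), Lemma 13.6] [cite: CossartPiltant2008, (16), Lemma 4.5 (2)]
[cite: Hauser2010, §§F–G]  bears_on: LADDER-RESOLUTION:D157-DOOR2 (res-dim4-pi · K2(p) · slice C (5,4) D∞ · L₄).  Supports
stmt-ResolutionOfSingularities-16155 (helper).
-/

set_option linter.dupNamespace false -- mandated namespace of this single-conjunct summit

noncomputable section

namespace Summit.ResolutionOfSingularities.ResolutionOfSingularities.Theorems.PIDim4


namespace ResCone

open MvPolynomial Finset IsLocalRing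
open Literature.AlgebraicGeometry.Resolution
open Literature.AlgebraicGeometry.Resolution.CentreBlowup
open Literature.AlgebraicGeometry.Resolution.Hauser2010
open Literature.AlgebraicGeometry.Resolution.HauserPerlega2019
open Literature.AlgebraicGeometry.Resolution.WeightedOrder
open PointBlowup (direction additiveSubspace)

variable {K : Type} [Field K]

section Lose

variable [CharP K 5] [DecidableEq K]

/-- **THE D∞ LOSE STEP (L₄ of the heavy-line assembly, `EntryInv₄`/`RunInv₄` unfolded).**  See the module docstring. [OURS]
[cite: CossartJannsenSaito2020, Lemma 12.1 (3), Lemma 12.2 (1), Lemma 13.6] [cite: CossartPiltant2008, Lemma 4.5 (2)] -/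
theorem dInf_lose_step {c : ℕ → State K} {j : ℕ → Fin 4} {b : ℕ → Fin 4 → K}
    (hc : ∀ k, IsIsolated 5 (c k).F ∧ Step0 5 (c k) (c (k + 1))) (hw : FreeTail.IsWitnessedChain 5 c j b)
    (hr0 : ∀ e ∈ (c 0).F.support, (c 0).r ≤ e) (hfloor : ∀ k, ordZero (c k).F ≠ 5) {k₀ : ℕ}
    (hshade : ∀ k, k₀ ≤ k → (c k).shade = ((4 : ℕ) : ℕ∞))
    (he : ∀ k, k₀ ≤ k → Module.finrank K (resVertex (c k)) = 2)
    {k : ℕ} (hk : k₀ ≤ k) (h3 : (c k).r.degree = 3) {h : Fin 4} {L : Fin (2 + 2) → Fin 4 → K}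
    {M : Fin 4 → Fin (2 + 2) → K} (hM : ∀ t u, ∑ i, M t i * L i u = if t = u then 1 else 0)
    (hLu1 : L (u1 2) = Pi.single h 1)
    (hy : ∀ i, i ≠ u1 2 → i ≠ u2 2 → ∀ w ∈ resVertex (c k), ∑ t, L i t * w t = 0) (hrh : (c k).r h = 2)
    (hne : (pts (fun i => algebraMap (MvPolynomial (Fin 4) K) (OriginLocalization K 4) (∑ t, C (L i t) * X t))
      (Ideal.span {algebraMap (MvPolynomial (Fin 4) K) (OriginLocalization K 4) ((c k).F.divMonomial (c k).r)}) 4).Nonempty)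
    (hδ : Nat.factorial 4 < deltaS (fun i => algebraMap (MvPolynomial (Fin 4) K) (OriginLocalization K 4) (∑ t, C (L i t) * X t))
      (Ideal.span {algebraMap (MvPolynomial (Fin 4) K) (OriginLocalization K 4) ((c k).F.divMonomial (c k).r)}) 4) :
    ∃ (L' : Fin (2 + 2) → Fin 4 → K) (M' : Fin 4 → Fin (2 + 2) → K),
      ((∀ t u, ∑ i, M' t i * L' i u = if t = u then 1 else 0) ∧ L' (u1 2) = Pi.single (j k) 1 ∧
        (∀ i, i ≠ u1 2 → i ≠ u2 2 → ∀ w ∈ resVertex (c (k + 1)), ∑ t, L' i t * w t = 0) ∧ (c (k + 1)).r (j k) = 2 ∧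
        (pts (fun i => algebraMap (MvPolynomial (Fin 4) K) (OriginLocalization K 4) (∑ t, C (L' i t) * X t))
          (Ideal.span {algebraMap (MvPolynomial (Fin 4) K) (OriginLocalization K 4)
            ((c (k + 1)).F.divMonomial (c (k + 1)).r)}) 4).Nonempty ∧
        Nat.factorial 4 < deltaS (fun i => algebraMap (MvPolynomial (Fin 4) K) (OriginLocalization K 4) (∑ t, C (L' i t) * X t))
          (Ideal.span {algebraMap (MvPolynomial (Fin 4) K) (OriginLocalization K 4)
            ((c (k + 1)).F.divMonomial (c (k + 1)).r)}) 4 ∧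
        2 * alphaS (fun i => algebraMap (MvPolynomial (Fin 4) K) (OriginLocalization K 4) (∑ t, C (L' i t) * X t))
          (Ideal.span {algebraMap (MvPolynomial (Fin 4) K) (OriginLocalization K 4)
            ((c (k + 1)).F.divMonomial (c (k + 1)).r)}) 4 ≤ Nat.factorial 4) ∧
      0 < alphaS (fun i => algebraMap (MvPolynomial (Fin 4) K) (OriginLocalization K 4) (∑ t, C (L' i t) * X t))
          (Ideal.span {algebraMap (MvPolynomial (Fin 4) K) (OriginLocalization K 4)
            ((c (k + 1)).F.divMonomial (c (k + 1)).r)}) 4 ∧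
      betaS (fun i => algebraMap (MvPolynomial (Fin 4) K) (OriginLocalization K 4) (∑ t, C (L' i t) * X t))
          (Ideal.span {algebraMap (MvPolynomial (Fin 4) K) (OriginLocalization K 4)
            ((c (k + 1)).F.divMonomial (c (k + 1)).r)}) 4 ≤
        betaS (fun i => algebraMap (MvPolynomial (Fin 4) K) (OriginLocalization K 4) (∑ t, C (L i t) * X t))
          (Ideal.span {algebraMap (MvPolynomial (Fin 4) K) (OriginLocalization K 4) ((c k).F.divMonomial (c k).r)}) 4 := by
  classical
  haveI : Fact (Nat.Prime 5) := ⟨by norm_num⟩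
  have h24 : Nat.factorial 4 = 24 := by decide
  set alg := algebraMap (MvPolynomial (Fin 4) K) (OriginLocalization K 4) with halg
  -- (0) the data of the step
  obtain ⟨hF, hd, hp, hdiv⟩ := dInf_factorisation hc hw hr0 hfloor hshade hk
  obtain ⟨hF', hd'⟩ := dInf_step_factorisation hc hw hr0 hfloor hshade hk
  obtain ⟨hF₁, hd₁, -, -⟩ := dInf_factorisation hc hw hr0 hfloor hshade (k := k + 1) (by omega)
  set G := (c k).F.divMonomial (c k).r with hG
  set G₁ := (c (k + 1)).F.divMonomial (c (k + 1)).r with hG₁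
  have hstep : c (k + 1) = CentreBlowup.step 5 Finset.univ (j k) (b k) (c k) := (hw k).2.2.2.2
  have hbj : b k (j k) = 0 := (hw k).2.1
  obtain ⟨-, hQ, -⟩ := dInf_pattern hc hw hr0 hfloor hshade hk hrh
  obtain ⟨hhit, hr'⟩ := hQ h3
  -- (1) the direction of the step lies in the vertex; the y-rows kill it
  have ho : ordZero (c k).F = ((7 : ℕ) : ℕ∞) := by
    rw [hF, PhiLine.ordZero_monomial_one_mul, hd, h3]; rfl
  have heq : (CentreBlowup.step 5 Finset.univ (j k) (b k) (c k)).shade = (c k).shade := by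
    rw [← hstep, hshade (k + 1) (by omega), hshade k hk]
  have hdirV : direction (j k) (b k) ∈ resVertex (c k) :=
    direction_mem_resVertex_of_shade_eq (j k) hbj ho hdiv (by norm_num) (by norm_num) heq
  have hdir : direction (j k) (b k) = Function.update (b k) (j k) 1 := rfl
  have hdirj : direction (j k) (b k) (j k) = 1 := by rw [hdir, Function.update_self]
  have hdirh : direction (j k) (b k) h ≠ 0 := by
    rcases hhit with hjh | hbh
    · rw [← hjh, hdirj]; exact one_ne_zero
    · have hjh : j k ≠ h := fun hh => hbh (by rw [← hh]; exact hbj)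
      rw [hdir, Function.update_of_ne (Ne.symm hjh)]; exact hbh
  have hyk : ∀ i, i ≠ u1 2 → i ≠ u2 2 → ∑ t, L i t * direction (j k) (b k) t = 0 := fun i h1 h2 => hy i h1 h2 _ hdirV
  -- (2) the twist `ũ₂ = u₂ − λ u₁`
  set lam : K := (∑ t, L (u2 2) t * direction (j k) (b k) t) * (direction (j k) (b k) h)⁻¹ with hlam
  set S : Fin (2 + 2) → Fin 4 → K := Function.update L (u2 2) (L (u2 2) - lam • L (u1 2)) with hS
  have hSq : S (u2 2) = L (u2 2) - lam • L (u1 2) := by rw [hS, Function.update_self]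
  have hSi : ∀ i, i ≠ u2 2 → S i = L i := fun i hi => by rw [hS, Function.update_of_ne hi]
  have hSu1 : S (u1 2) = Pi.single h 1 := by rw [hSi _ u1_ne_u2, hLu1]
  have hMS := twist_left_inverse hM u1_ne_u2 lam hSq hSi
  set MS : Fin 4 → Fin (2 + 2) → K := fun t i => M t i + if i = u1 2 then lam * M t (u2 2) else 0 with hMSdef
  have hMS' : ∀ t u, ∑ i, MS t i * S i u = if t = u then 1 else 0 := hMS
  have hkill : ∀ i, i ≠ u1 2 → ∑ t, S i t * direction (j k) (b k) t = 0 := by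
    intro i hi
    by_cases hi2 : i = u2 2
    · subst hi2
      rw [hSq]
      simp only [Pi.sub_apply, Pi.smul_apply, smul_eq_mul, sub_mul, Finset.sum_sub_distrib, mul_assoc, ← Finset.mul_sum]
      rw [hLu1, sum_single_mul, hlam, inv_mul_cancel_right₀ hdirh, sub_self]
    · rw [hSi i hi2]; exact hyk i hi hi2
  have hyS : ∀ i, i ≠ u1 2 → i ≠ u2 2 → ∀ w ∈ resVertex (c k), ∑ t, S i t * w t = 0 := fun i h1 h2 w hw' => by
    rw [hSi i h2]; exact hy i h1 h2 w hw'
  -- the polygon data in the twisted frame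
  have hgenL := span_range_frame_eq_maximalIdeal L M hM
  have hgenS := span_range_frame_eq_maximalIdeal S MS hMS'
  have hdim := PhiLine.ringKrullDim_originLocalization_two_add_two (K := K)
  have hJμ : Ideal.span {alg G} ≤ maximalIdeal (OriginLocalization K 4) ^ 4 :=
    PhiLine.span_singleton_algebraMap_le_maximalIdeal_pow hd.symm.le
  have hframeS := frameRow_twist (K := K) lam hSq hSi
  obtain ⟨hneS, hδS, hβS⟩ := PhiLine.twist_binders (fun i => alg (∑ t, C (L i t) * X t)) hgenL hdim (-alg (C lam)) hJμ hne hδ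
  rw [← halg] at hframeS
  rw [← hframeS] at hneS hδS hβS
  -- (3) the common tail: from an arrival frame with the law's outputs to the run invariant
  have hBS := matrix_mul_eq_one_of_sum (L := S) (M := MS) hMS'
  have hSB := mul_eq_one_comm.mp hBS
  obtain ⟨Ψ, hΨ, hΨA, Q, hQmem, hGΨ⟩ :=
    PhiLine.exists_label_of_yRows_annihilate 5 (by norm_num) hF hd hSB hBS (he k hk) hyS
  have hnear2 : ∀ i : Fin 2, ∑ t, S (Fin.castAdd 2 i) t * Function.update (b k) (j k) 1 t = 0 := fun i => by
    rw [← hdir]; exact hkill _ (castAdd_ne_u1 i)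
  obtain ⟨Q', hH₀⟩ := PhiLine.chartTransform_translate_label hbj (fun i : Fin 2 => S (Fin.castAdd 2 i)) hnear2 hΨ hQmem hGΨ
    hd.symm.le
  obtain ⟨R, hres, hRmem⟩ := PhiLine.step_F_eq_monomial_mul_residual (p := 5) hF hd.symm.le hp (j k) hbj
  rw [hF', monomial_one_mul_cancel_left_iff] at hres
  have hr'j : (((c k).r.filter fun i => b k i = 0).update (j k) ((c k).r.degree + 4 - 5)) (j k) = 2 := by
    rw [Finsupp.coe_update, Function.update_self, h3]
  have hR : R ∈ Ideal.span {(X (j k) : MvPolynomial (Fin 4) K) ^ 3} := by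
    have := hRmem (j k) (by rw [hr'j]; decide)
    rwa [hr'j] at this
  have hε := PhiLine.constantCoeff_prod_ne_zero (b k) (fun i => (c k).r i)
  have hT := PhiLine.two_le_finrank_additiveSubspace_of_resVertex hF₁ hd₁ (he (k + 1) (by omega))
  have hcrit₁ : 5 ≤ (c (k + 1)).r (j k) + 3 := by rw [hr']
  have tail : ∀ (L' : Fin (2 + 2) → Fin 4 → K) (M' : Fin 4 → Fin (2 + 2) → K),
      (∀ t u, ∑ i, M' t i * L' i u = if t = u then 1 else 0) → L' (u1 2) = Pi.single (j k) 1 →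
      (∀ i, i ≠ u1 2 → L' i = Function.update (S i) (j k) 0) →
      alphaS (fun i => alg (∑ t, C (L' i t) * X t)) (Ideal.span {alg G₁}) 4 + Nat.factorial 4 =
        deltaS (fun i => alg (∑ t, C (S i t) * X t)) (Ideal.span {alg G}) 4 →
      betaS (fun i => alg (∑ t, C (L' i t) * X t)) (Ideal.span {alg G₁}) 4 ≤
        betaS (fun i => alg (∑ t, C (S i t) * X t)) (Ideal.span {alg G}) 4 →
      ∃ (L'' : Fin (2 + 2) → Fin 4 → K) (M'' : Fin 4 → Fin (2 + 2) → K),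
        ((∀ t u, ∑ i, M'' t i * L'' i u = if t = u then 1 else 0) ∧ L'' (u1 2) = Pi.single (j k) 1 ∧
          (∀ i, i ≠ u1 2 → i ≠ u2 2 → ∀ w ∈ resVertex (c (k + 1)), ∑ t, L'' i t * w t = 0) ∧ (c (k + 1)).r (j k) = 2 ∧
          (pts (fun i => alg (∑ t, C (L'' i t) * X t)) (Ideal.span {alg G₁}) 4).Nonempty ∧
          Nat.factorial 4 < deltaS (fun i => alg (∑ t, C (L'' i t) * X t)) (Ideal.span {alg G₁}) 4 ∧
          2 * alphaS (fun i => alg (∑ t, C (L'' i t) * X t)) (Ideal.span {alg G₁}) 4 ≤ Nat.factorial 4) ∧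
        0 < alphaS (fun i => alg (∑ t, C (L'' i t) * X t)) (Ideal.span {alg G₁}) 4 ∧
        betaS (fun i => alg (∑ t, C (L'' i t) * X t)) (Ideal.span {alg G₁}) 4 ≤
          betaS (fun i => alg (∑ t, C (L i t) * X t)) (Ideal.span {alg G}) 4 := by
    intro L' M' hM' hL'u1 hL' hαeq hβle
    -- the child's polygon in the arrival frame: non-empty, `4·αs′ ≤ 2·4!` ((K-Φ1)-n at the heavy newborn), hence `0 < αs′ < 4!`
    have hgen' := span_range_frame_eq_maximalIdeal L' M' hM'
    have hu1' : (fun i => alg (∑ t, C (L' i t) * X t)) (u1 2) = alg (X (j k)) := by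
      show alg (∑ t, C (L' (u1 2) t) * X t) = alg (X (j k))
      rw [hL'u1, halg, frameRow_single]
    obtain ⟨hne', hα2⟩ := PhiLine.mul_alphaS_le_of_isIsolated (p := 5) (d := 4) (n := 3) hF₁ (hc (k + 1)).1 hcrit₁
      (by norm_num) (fun i => alg (∑ t, C (L' i t) * X t)) hgen' hu1'
    have hα2' : 4 * alphaS (fun i => alg (∑ t, C (L' i t) * X t)) (Ideal.span {alg G₁}) 4 ≤ (3 - 1) * Nat.factorial 4 := hα2
    have hα12 : 2 * alphaS (fun i => alg (∑ t, C (L' i t) * X t)) (Ideal.span {alg G₁}) 4 ≤ Nat.factorial 4 := by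
      rw [h24] at hα2' ⊢; omega
    have hα' : alphaS (fun i => alg (∑ t, C (L' i t) * X t)) (Ideal.span {alg G₁}) 4 < Nat.factorial 4 := by
      rw [h24] at hα2' ⊢; omega
    have hα0 : 0 < alphaS (fun i => alg (∑ t, C (L' i t) * X t)) (Ideal.span {alg G₁}) 4 := by
      have := hδS; omega
    -- the re-adaptation (XVI, `e = 3`, no order hypothesis on the uncleaned weak transform) and the new y-rows (XIII)
    have hB'A := matrix_mul_eq_one_of_sum (L := L') (M := M') hM'
    have hAB' := mul_eq_one_comm.mp hB'A
    have hfun : (fun i : Fin 2 => ∑ t, C (Function.update (S (Fin.castAdd 2 i)) (j k) 0 t) * X t) =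
        (fun i : Fin 2 => ∑ t, C (L' (Fin.castAdd 2 i) t) * X t) := by
      funext i
      rw [hL' _ (castAdd_ne_u1 i)]
    have hH₀' : PointBlowup.translate (b k) (CentreBlowup.chartTransform 4 Finset.univ (j k) G) =
        aeval (fun i : Fin 2 => ∑ t, C (L' (Fin.castAdd 2 i) t) * X t) Ψ + X (j k) * Q' := by
      rw [hH₀, hfun]
    have hu12 : u1 2 ∈ ({u1 2, u2 2} : Finset (Fin (2 + 2))) := Finset.mem_insert_self _ _
    obtain ⟨lam', A', B', hA'B', hB'A', hrows, hA'u1, hA'u2, hne'', hδ'', hαeq'', hβeq''⟩ :=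
      PhiLine.exists_label_readaptation_of_step_pow 5 (d := 4) (by norm_num) hAB' hB'A hu12 hL'u1 hL'u1
        (e := 3) (by norm_num) hres hd' hε hR hH₀' hΨ hΨA hT hne' hα0 hα'
    have hy'' := PhiLine.yRows_annihilate_of_label 5 (by norm_num : 4 < 5) hF₁ hd₁ hA'B' hB'A' (he (k + 1) (by omega)) hδ''
    refine ⟨A', B', ⟨sum_of_matrix_mul_eq_one hB'A', by rw [hA'u1, hL'u1], hy'', hr', hne'', hδ'', by rw [hαeq'']; exact hα12⟩,
      by rw [hαeq'']; exact hα0, ?_⟩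
    rw [hβeq'']
    exact hβle.trans hβS
  -- (4) the two charts
  rcases hhit with hjh | hbh
  · -- chart `h`: the LOSE law from the child side at the supercritical newborn (XV §4, `n = 3`)
    set L' : Fin (2 + 2) → Fin 4 → K := fun i => if i = u1 2 then Pi.single h 1 else Function.update (S i) h 0 with hL'def
    have hL'u1 : L' (u1 2) = Pi.single h 1 := by rw [hL'def]; exact if_pos rfl
    have hL' : ∀ i, i ≠ u1 2 → L' i = Function.update (S i) h 0 := fun i hi => by rw [hL'def]; exact if_neg hi
    have hM' := arrival_left_inverse hMS' hSu1 hL'u1 hL'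
    have hbh : b k h = 0 := by rw [← hjh]; exact hbj
    have hnear : ∀ i, i ≠ u1 2 → ∑ t, S i t * Function.update (b k) h 1 t = 0 := fun i hi => by
      rw [← hjh, ← hdir]; exact hkill i hi
    have hgen' := span_range_frame_eq_maximalIdeal L' _ hM'
    have hu1' : (fun i => alg (∑ t, C (L' i t) * X t)) (u1 2) = alg (X h) := by
      show alg (∑ t, C (L' (u1 2) t) * X t) = alg (X h)
      rw [hL'u1, halg, frameRow_single]
    obtain ⟨hne', hα2⟩ := PhiLine.mul_alphaS_le_of_isIsolated (p := 5) (d := 4) (n := 3) hF₁ (hc (k + 1)).1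
      (h := h) (by rw [← hjh]; exact hcrit₁) (by norm_num) (fun i => alg (∑ t, C (L' i t) * X t)) hgen' hu1'
    have hα2' : 4 * alphaS (fun i => alg (∑ t, C (L' i t) * X t)) (Ideal.span {alg G₁}) 4 ≤ (3 - 1) * Nat.factorial 4 := hα2
    have hα' : 4 * (alphaS (fun i => alg (∑ t, C (L' i t) * X t)) (Ideal.span {alg G₁}) 4 + 1) ≤ 3 * Nat.factorial 4 := by
      rw [h24] at hα2' ⊢; omega
    have hF'' : (CentreBlowup.step 5 Finset.univ h (b k) (c k)).F =
        monomial (((c k).r.filter fun i => b k i = 0).update h ((c k).r.degree + 4 - 5)) 1 * G₁ := by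
      rw [← hjh]; exact hF'
    obtain ⟨hαeq, hβle⟩ := PhiLine.betaS_step_le_of_lose_of_child_pow (n := 3) hF hd hp hbh (by rw [h3]; decide)
      (by rw [h3]) S L' MS _ hMS' hM' hSu1 hnear hL'u1 hL' hneS hδS hF'' hd' hne' hα'
    exact tail L' _ hM' (by rw [hL'u1, hjh]) (fun i hi => by rw [hL' i hi, hjh]) hαeq hβle
  · -- chart `j k ≠ h`, `b k h ≠ 0`: the translated law at the supercritical newborn (R3b-n)
    have hjh : j k ≠ h := fun hh => hbh (by rw [← hh]; exact hbj)
    -- replace the pivot row by `e_{j k}`, then drop the `j k`-coefficients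
    set S₂ : Fin (2 + 2) → Fin 4 → K := Function.update S (u1 2) (Pi.single (j k) 1) with hS₂
    have hS₂u1 : S₂ (u1 2) = Pi.single (j k) 1 := by rw [hS₂, Function.update_self]
    have hS₂i : ∀ i, i ≠ u1 2 → S₂ i = S i := fun i hi => by rw [hS₂, Function.update_of_ne hi]
    have ha : ∑ t, (Pi.single (j k) (1 : K) : Fin 4 → K) t * MS t (u1 2) ≠ 0 :=
      coeff_replaceRow_ne_zero hMS' (piv := u1 2) (w := direction (j k) (b k)) hkill (by rw [sum_single_mul, hdirj]; exact one_ne_zero)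
    have hM₂ := replaceRow_left_inverse hMS' (u1 2) (Pi.single (j k) 1) ha hS₂u1 hS₂i
    set L' : Fin (2 + 2) → Fin 4 → K := fun i => if i = u1 2 then Pi.single (j k) 1 else Function.update (S i) (j k) 0
      with hL'def
    have hL'u1 : L' (u1 2) = Pi.single (j k) 1 := by rw [hL'def]; exact if_pos rfl
    have hL' : ∀ i, i ≠ u1 2 → L' i = Function.update (S i) (j k) 0 := fun i hi => by rw [hL'def]; exact if_neg hi
    have hL'₂ : ∀ i, i ≠ u1 2 → L' i = Function.update (S₂ i) (j k) 0 := fun i hi => by rw [hL' i hi, hS₂i i hi]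
    have hM' := arrival_left_inverse hM₂ hS₂u1 hL'u1 hL'₂
    have hnear : ∀ i, i ≠ u1 2 → ∑ t, S i t * Function.update (b k) (j k) 1 t = 0 := fun i hi => by
      rw [← hdir]; exact hkill i hi
    have hgen' := span_range_frame_eq_maximalIdeal L' _ hM'
    have hu1' : (fun i => alg (∑ t, C (L' i t) * X t)) (u1 2) = alg (X (j k)) := by
      show alg (∑ t, C (L' (u1 2) t) * X t) = alg (X (j k))
      rw [hL'u1, halg, frameRow_single]
    obtain ⟨hne', hα2⟩ := PhiLine.mul_alphaS_le_of_isIsolated (p := 5) (d := 4) (n := 3) hF₁ (hc (k + 1)).1 hcrit₁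
      (by norm_num) (fun i => alg (∑ t, C (L' i t) * X t)) hgen' hu1'
    have hα2' : 4 * alphaS (fun i => alg (∑ t, C (L' i t) * X t)) (Ideal.span {alg G₁}) 4 ≤ (3 - 1) * Nat.factorial 4 := hα2
    have hα' : 4 * (alphaS (fun i => alg (∑ t, C (L' i t) * X t)) (Ideal.span {alg G₁}) 4 + 1) ≤ 3 * Nat.factorial 4 := by
      rw [h24] at hα2' ⊢; omega
    obtain ⟨hαeq, hβle⟩ := PhiLine.betaS_step_le_of_lose_translated_of_child_pow (n := 3) hF hd hp hjh hbj hbh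
      (by rw [h3]; decide) (by rw [h3]) S L' MS _ hMS' hM' hSu1 hnear hL'u1 hL' hneS hδS hF' hd' hne' hα'
    exact tail L' _ hM' hL'u1 hL' hαeq hβle

/-- **L₄ IN THE ASSEMBLY'S SHAPE**: the named hypothesis `hL` of res-dim4-p-7 g5's `no_dInf_tail_four_five_of_EL`
(`…ResConeDInfAssembly`) — `EntryInv₄ ⇒ RunInv₄` at the child with `βs′ ≤ βs`, per chain, at every `(2,1)`-state — discharged by
`dInf_lose_step` (the parent's `2·αs ≤ 4!` conjunct is not needed). [OURS] [cite: CossartJannsenSaito2020, Lemma 12.1 (3), Lemma 13.6] -/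
theorem dInf_stub_lose {c : ℕ → State K} {j : ℕ → Fin 4} {b : ℕ → Fin 4 → K}
    (hc : ∀ k, IsIsolated 5 (c k).F ∧ Step0 5 (c k) (c (k + 1))) (hw : FreeTail.IsWitnessedChain 5 c j b)
    (hr0 : ∀ e ∈ (c 0).F.support, (c 0).r ≤ e) (hfloor : ∀ k, ordZero (c k).F ≠ 5) {k₀ : ℕ}
    (hshade : ∀ k, k₀ ≤ k → (c k).shade = ((4 : ℕ) : ℕ∞))
    (he : ∀ k, k₀ ≤ k → Module.finrank K (resVertex (c k)) = 2) :
    ∀ k, k₀ ≤ k → (c k).r.degree = 3 → ∀ (h : Fin 4) (L : Fin (2 + 2) → Fin 4 → K) (M : Fin 4 → Fin (2 + 2) → K),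
      ((∀ t u, ∑ i, M t i * L i u = if t = u then 1 else 0) ∧ L (u1 2) = Pi.single h 1 ∧
        (∀ i, i ≠ u1 2 → i ≠ u2 2 → ∀ w ∈ resVertex (c k), ∑ t, L i t * w t = 0) ∧ (c k).r h = 2 ∧
        (pts (fun i => algebraMap (MvPolynomial (Fin 4) K) (OriginLocalization K 4) (∑ t, C (L i t) * X t))
          (Ideal.span {algebraMap (MvPolynomial (Fin 4) K) (OriginLocalization K 4)
            ((c k).F.divMonomial (c k).r)}) 4).Nonempty ∧
        Nat.factorial 4 < deltaS (fun i => algebraMap (MvPolynomial (Fin 4) K) (OriginLocalization K 4) (∑ t, C (L i t) * X t))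
          (Ideal.span {algebraMap (MvPolynomial (Fin 4) K) (OriginLocalization K 4)
            ((c k).F.divMonomial (c k).r)}) 4 ∧
        2 * alphaS (fun i => algebraMap (MvPolynomial (Fin 4) K) (OriginLocalization K 4) (∑ t, C (L i t) * X t))
          (Ideal.span {algebraMap (MvPolynomial (Fin 4) K) (OriginLocalization K 4)
            ((c k).F.divMonomial (c k).r)}) 4 ≤ Nat.factorial 4) →
      ∃ (L' : Fin (2 + 2) → Fin 4 → K) (M' : Fin 4 → Fin (2 + 2) → K),
        (((∀ t u, ∑ i, M' t i * L' i u = if t = u then 1 else 0) ∧ L' (u1 2) = Pi.single (j k) 1 ∧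
            (∀ i, i ≠ u1 2 → i ≠ u2 2 → ∀ w ∈ resVertex (c (k + 1)), ∑ t, L' i t * w t = 0) ∧ (c (k + 1)).r (j k) = 2 ∧
            (pts (fun i => algebraMap (MvPolynomial (Fin 4) K) (OriginLocalization K 4) (∑ t, C (L' i t) * X t))
              (Ideal.span {algebraMap (MvPolynomial (Fin 4) K) (OriginLocalization K 4)
            ((c (k + 1)).F.divMonomial (c (k + 1)).r)}) 4).Nonempty ∧
            Nat.factorial 4 < deltaS (fun i => algebraMap (MvPolynomial (Fin 4) K) (OriginLocalization K 4) (∑ t, C (L' i t) * X t))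
              (Ideal.span {algebraMap (MvPolynomial (Fin 4) K) (OriginLocalization K 4)
            ((c (k + 1)).F.divMonomial (c (k + 1)).r)}) 4 ∧
            2 * alphaS (fun i => algebraMap (MvPolynomial (Fin 4) K) (OriginLocalization K 4) (∑ t, C (L' i t) * X t))
              (Ideal.span {algebraMap (MvPolynomial (Fin 4) K) (OriginLocalization K 4)
            ((c (k + 1)).F.divMonomial (c (k + 1)).r)}) 4 ≤ Nat.factorial 4) ∧
          0 < alphaS (fun i => algebraMap (MvPolynomial (Fin 4) K) (OriginLocalization K 4) (∑ t, C (L' i t) * X t))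
            (Ideal.span {algebraMap (MvPolynomial (Fin 4) K) (OriginLocalization K 4)
            ((c (k + 1)).F.divMonomial (c (k + 1)).r)}) 4) ∧
        betaS (fun i => algebraMap (MvPolynomial (Fin 4) K) (OriginLocalization K 4) (∑ t, C (L' i t) * X t))
          (Ideal.span {algebraMap (MvPolynomial (Fin 4) K) (OriginLocalization K 4)
            ((c (k + 1)).F.divMonomial (c (k + 1)).r)}) 4 ≤
          betaS (fun i => algebraMap (MvPolynomial (Fin 4) K) (OriginLocalization K 4) (∑ t, C (L i t) * X t))
          (Ideal.span {algebraMap (MvPolynomial (Fin 4) K) (OriginLocalization K 4)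
            ((c k).F.divMonomial (c k).r)}) 4 := by
  intro k hk h3 h L M hinv
  obtain ⟨hM, hLu1, hy, hrh, hne, hδ, -⟩ := hinv
  obtain ⟨L', M', h7, hpos, hle⟩ := dInf_lose_step hc hw hr0 hfloor hshade he hk h3 hM hLu1 hy hrh hne hδ
  exact ⟨L', M', ⟨h7, hpos⟩, hle⟩

end Lose

end ResCone

end Summit.ResolutionOfSingularities.ResolutionOfSingularities.Theorems.PIDim4

end
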